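import Literature.Analysis.FluidPDE.Seregin2020AncientLimitSymmetry
import HarnessLib

/-!
# Crux `RecurrentLiouville` (stmt-NavierStokesRegularity-1589), line `Sketch` — stub
# `stub_rlAxisymOfLimit`: `L³(Q(0, 2))` limits of nearly axisymmetric fields are a.e. axisymmetric

Theorems-only file (no definitions, no named facts), pure measure theory for Branch C of the line
(removal of near-axisymmetric profiles by contradiction and compactness).  Let `v_k → w` in
`L³(Q(0, 2))`, `Q(0, 2) = ]-4, 0[ × B(0, 2)`, and let `a_k` be fields with every slice `a_k(t, ·)`
axisymmetric about the `x₃`-axis (`IsAxisymmetric`: `a (R_θ x) = R_θ (a x)` for all rotations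
`R_θ = rotZ θ`) and `‖v_k − a_k‖_{L³(Q(0,2))} ≤ δ_k → 0`.  Then for every angle `θ` the limit is
axisymmetric almost everywhere on `Q(0, 2)`: `w(t, R_θ x) = R_θ w(t, x)` for a.e. `(t, x) ∈ Q(0, 2)`
(`stub_rlAxisymOfLimit`).

Proof.  (1) `a_k → w` in `L³(Q(0, 2))` as well:
`‖a_k − w‖ ≤ ‖a_k − v_k‖ + ‖v_k − w‖ ≤ δ_k + ‖v_k − w‖ → 0` (triangle inequality and a squeeze,
`rlAxisymOfLimit_tendsto_eLpNorm_sub_of_near`).  (2) Axisymmetry passes to strong `L³(Q(a))`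
limits in the a.e. sense: the space–time rotation `(t, x) ↦ (t, R_θ x)` preserves Lebesgue measure
restricted to `Q(0, 2)`, so `a_k ∘ (id × R_θ) → w ∘ (id × R_θ)` and `R_θ ∘ a_k → R_θ ∘ w` in `L³`,
and the two left-hand sides coincide; this is the tree's
`Seregin2020.ae_rot_eq_of_tendsto_eLpNorm` (Seregin 2020, proof of Thm. 2.1, property (𝒜)(ii)).

## References

* G. Seregin, Anal. Math. Phys. 10 (2020), Paper 46 = arXiv:2006.04140, proof of Thm. 2.1,
  property (𝒜)(ii). [Seregin2020]
* G. Koch, N. Nadirashvili, G. Seregin, V. Šverák, Acta Math. 203 (2009), §1, (1.5). [KNSS2009]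
-/

noncomputable section

-- the sub-problem namespace repeats the summit name (D-0017 layout `Summit.<S>.<P>.Theorems`)
set_option linter.dupNamespace false

namespace Summit.NavierStokesRegularity.NavierStokesRegularity.Theorems

open MeasureTheory Set Function Filter Topology TopologicalSpace Metric
open Literature.Analysis.FluidPDE
open scoped NNReal ENNReal

/-! ### An abstract `L^p` squeeze -/

/-- If `V_k → W` in `L^p` and `‖V_k − A_k‖_{L^p} ≤ δ_k → 0`, then `A_k → W` in `L^p`
(triangle inequality `‖A_k − W‖ ≤ ‖A_k − V_k‖ + ‖V_k − W‖` and a squeeze). [folklore] -/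
private theorem rlAxisymOfLimit_tendsto_eLpNorm_sub_of_near {α E : Type*}
    {m : MeasurableSpace α} {μ : Measure α} [NormedAddCommGroup E] {p : ℝ≥0∞} (hp : 1 ≤ p)
    {W : α → E} {V A : ℕ → α → E} {δ : ℕ → ℝ}
    (hW : AEStronglyMeasurable W μ)
    (hV : ∀ k, AEStronglyMeasurable (V k) μ) (hA : ∀ k, AEStronglyMeasurable (A k) μ)
    (h1 : Tendsto (fun k => eLpNorm (V k - W) p μ) atTop (𝓝 0))
    (h2 : ∀ k, eLpNorm (V k - A k) p μ ≤ ENNReal.ofReal (δ k)) (hδ : Tendsto δ atTop (𝓝 0)) :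
    Tendsto (fun k => eLpNorm (A k - W) p μ) atTop (𝓝 0) := by
  have hle : ∀ k, eLpNorm (A k - W) p μ ≤ ENNReal.ofReal (δ k) + eLpNorm (V k - W) p μ := by
    intro k
    have e : A k - W = (A k - V k) + (V k - W) := by rw [sub_add_sub_cancel]
    calc eLpNorm (A k - W) p μ ≤ eLpNorm (A k - V k) p μ + eLpNorm (V k - W) p μ := by
          rw [e]
          exact eLpNorm_add_le ((hA k).sub (hV k)) ((hV k).sub hW) hp
      _ ≤ ENNReal.ofReal (δ k) + eLpNorm (V k - W) p μ := by
          rw [eLpNorm_sub_comm]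
          exact add_le_add (h2 k) le_rfl
  have hδ' : Tendsto (fun k => ENNReal.ofReal (δ k)) atTop (𝓝 0) := by
    have h := ENNReal.tendsto_ofReal hδ
    rwa [ENNReal.ofReal_zero] at h
  have hlim := hδ'.add h1
  rw [add_zero] at hlim
  exact tendsto_of_tendsto_of_tendsto_of_le_of_le tendsto_const_nhds hlim (fun _ => zero_le) hle

/-! ### The stub -/

/-- **`L³(Q(0, 2))` limits of nearly axisymmetric fields are a.e. axisymmetric.**  If
`v_k → w` in `L³(Q(0, 2))`, every slice `a_k(t, ·)` is axisymmetric about the `x₃`-axis and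
`‖v_k − a_k‖_{L³(Q(0,2))} ≤ δ_k → 0`, then for every angle `θ`,
`w(t, R_θ x) = R_θ w(t, x)` for a.e. `(t, x) ∈ Q(0, 2)`: `a_k → w` in `L³(Q(0, 2))` by the
triangle inequality, and axisymmetry passes to strong `L³` limits on the rotation-invariant
parabolic balls (`Seregin2020.ae_rot_eq_of_tendsto_eLpNorm`; Seregin 2020, proof of Thm. 2.1,
property (𝒜)(ii)). [folklore] -/
theorem stub_rlAxisymOfLimit :
    ∀ (v a : ℕ → ℝ → EuclideanSpace ℝ (Fin 3) → EuclideanSpace ℝ (Fin 3))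
      (w : ℝ → EuclideanSpace ℝ (Fin 3) → EuclideanSpace ℝ (Fin 3)) (δ : ℕ → ℝ),
      Tendsto δ atTop (𝓝 0) →
      (∀ (k : ℕ) (t : ℝ), IsAxisymmetric (a k t)) →
      (∀ k, AEStronglyMeasurable (uncurry (v k))
        (volume.restrict (parabolicCylinder 2 (0 : ℝ × EuclideanSpace ℝ (Fin 3))))) →
      (∀ k, AEStronglyMeasurable (uncurry (a k))
        (volume.restrict (parabolicCylinder 2 (0 : ℝ × EuclideanSpace ℝ (Fin 3))))) →
      AEStronglyMeasurable (uncurry w)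
        (volume.restrict (parabolicCylinder 2 (0 : ℝ × EuclideanSpace ℝ (Fin 3)))) →
      Tendsto (fun k => eLpNorm (uncurry (v k) - uncurry w) 3
        (volume.restrict (parabolicCylinder 2 (0 : ℝ × EuclideanSpace ℝ (Fin 3))))) atTop (𝓝 0) →
      (∀ k, eLpNorm (uncurry (v k) - uncurry (a k)) 3
        (volume.restrict (parabolicCylinder 2 (0 : ℝ × EuclideanSpace ℝ (Fin 3)))) ≤ ENNReal.ofReal (δ k)) →
      ∀ θ : ℝ, ∀ᵐ z ∂(volume.restrict (parabolicCylinder 2 (0 : ℝ × EuclideanSpace ℝ (Fin 3)))),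
        w z.1 (rotZ θ z.2) = rotZ θ (w z.1 z.2) := by
  intro v a w δ hδ hax hvm ham hwm hconv hdev θ
  -- (1) `a_k → w` in `L³(Q(0, 2))`
  have hconv' : Tendsto (fun k => eLpNorm (uncurry (a k) - uncurry w) 3
      (volume.restrict (parabolicCylinder 2 (0 : ℝ × EuclideanSpace ℝ (Fin 3))))) atTop (𝓝 0) :=
    rlAxisymOfLimit_tendsto_eLpNorm_sub_of_near (by norm_num) hwm hvm ham hconv hdev hδ
  -- (2) axisymmetry passes to strong `L³(Q(0, 2))` limits
  exact Seregin2020.ae_rot_eq_of_tendsto_eLpNorm θ ham hwm (fun k z _ => hax k z.1 θ z.2) hconv'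

end Summit.NavierStokesRegularity.NavierStokesRegularity.Theorems
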